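import Literature.Analysis.FluidPDE.PassiveScalarDiagForcedClass
import HarnessLib

/-!
# Weak passive scalars with constant diagonal diffusion and a source: horizons, drifts, sources

Analysis/FluidPDE proof-support file (everything proved). Bookkeeping for the notion
`Torus.IsWeakScalarTransportDiagForcedOn T a κ u s θ₀ θ` (`PassiveScalarDiagForced`;
DiPerna–Lions 1989, §II.1 with a right-hand side): every clause is an integral over, or an a.e.
statement on, the time interval `(0,T)`, so

* `congr_velocity`, `congr_source` — replacing the drift / the source by fields that agree with
  them at every `t ∈ (0,T)` preserves weak solutions (isotropic twins:
  `KinematicSteadySourceLaw.congr_velocity` on the Summits side);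
* `mono` — a weak solution on `[0,T)` is one on `[0,T')` for `T' ≤ T`;
* `periodic_intPhase`, `intPhase_iff` — for a drift and a source `L`-periodic on `t ≥ 0`, the
  problem with the phase-`nL` drift `u (nL + ·)` and source `s (nL + ·)` has the same weak
  solutions as the phase-`0` problem (the "integer periods" clause of the restart property,
  `PassiveScalarDiagForcedRestart`).

## References

* R. J. DiPerna, P.-L. Lions, Invent. Math. 98 (1989), §II.1, (12)–(14). [`DiPernaLions1989`]
-/

noncomputable section

open _root_.MeasureTheory _root_.Set _root_.Filter _root_.Function _root_.TopologicalSpace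
open scoped ENNReal NNReal InnerProductSpace ContDiff

namespace Literature.Analysis.FluidPDE

namespace Torus

variable {d : Type*} [Fintype d] [DecidableEq d]

namespace IsWeakScalarTransportDiagForcedOn

variable {T κ : ℝ} {a : d → ℝ} {u : ℝ → UnitAddTorus d → EuclideanSpace ℝ d}
  {s : ℝ → UnitAddTorus d → ℝ} {θ₀ : UnitAddTorus d → ℝ} {θ : ℝ → UnitAddTorus d → ℝ}

/-! ## The notion only sees the drift and the source on `(0,T)` -/

/-- **The weak notion only sees the drift on `(0,T)`**: replacing `u` by a field `u'` that
agrees with it at every `t ∈ (0,T)` preserves weak solutions. [cite: DiPernaLions1989, §II.1 (12)–(14)] -/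
theorem congr_velocity {u' : ℝ → UnitAddTorus d → EuclideanSpace ℝ d}
    (huu' : ∀ t ∈ Ioo 0 T, u' t = u t) (h : IsWeakScalarTransportDiagForcedOn T a κ u s θ₀ θ) :
    IsWeakScalarTransportDiagForcedOn T a κ u' s θ₀ θ where
  aestronglyMeasurable := h.aestronglyMeasurable
  aestronglyMeasurable_velocity := by
    refine h.aestronglyMeasurable_velocity.congr ?_
    filter_upwards [ae_restrict_mem (measurableSet_Ioo.prod MeasurableSet.univ)] with p hp
    obtain ⟨t, y⟩ := p
    simp only [FunctionSpaces.Torus.stLift_apply, huu' t (mem_prod.1 hp).1]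
  aestronglyMeasurable_source := h.aestronglyMeasurable_source
  ae_lintegral_sq_le := h.ae_lintegral_sq_le
  lintegral_velocity_lt_top := by
    rw [setLIntegral_congr_fun measurableSet_Ioo
      (fun t ht => show (∫⁻ x, ‖u' t x‖ₑ ^ 2) ^ (1 / 2 : ℝ) = (∫⁻ x, ‖u t x‖ₑ ^ 2) ^ (1 / 2 : ℝ) by
        rw [huu' t ht])]
    exact h.lintegral_velocity_lt_top
  lintegral_mul_lt_top := by
    rw [setLIntegral_congr_fun measurableSet_Ioo
      (fun t ht => show ∫⁻ x, ‖u' t x‖ₑ * ‖θ t x‖ₑ = ∫⁻ x, ‖u t x‖ₑ * ‖θ t x‖ₑ by rw [huu' t ht])]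
    exact h.lintegral_mul_lt_top
  lintegral_source_lt_top := h.lintegral_source_lt_top
  ae_isWeaklyDivFree := by
    filter_upwards [h.ae_isWeaklyDivFree, ae_restrict_mem measurableSet_Ioo] with t ht ht'
    rw [huu' t ht']
    exact ht
  weak_eq ψ hψ := by
    rw [setIntegral_congr_fun measurableSet_Ioo
      (fun t ht => show (∫ x, θ t x * (FunctionSpaces.Torus.timeDeriv ψ t x +
          ⟪u' t x, FunctionSpaces.Torus.gradient (ψ t) x⟫_ℝ +
          κ * ∑ i, a i * FunctionSpaces.Torus.partialDeriv i
            (FunctionSpaces.Torus.partialDeriv i (ψ t)) x)) =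
        ∫ x, θ t x * (FunctionSpaces.Torus.timeDeriv ψ t x +
          ⟪u t x, FunctionSpaces.Torus.gradient (ψ t) x⟫_ℝ +
          κ * ∑ i, a i * FunctionSpaces.Torus.partialDeriv i
            (FunctionSpaces.Torus.partialDeriv i (ψ t)) x) by rw [huu' t ht])]
    exact h.weak_eq ψ hψ

/-- **The weak notion only sees the source on `(0,T)`**: replacing `s` by a field `s'` that
agrees with it at every `t ∈ (0,T)` preserves weak solutions. [cite: DiPernaLions1989, §II.1 (12)–(14)] -/
theorem congr_source {s' : ℝ → UnitAddTorus d → ℝ}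
    (hss' : ∀ t ∈ Ioo 0 T, s' t = s t) (h : IsWeakScalarTransportDiagForcedOn T a κ u s θ₀ θ) :
    IsWeakScalarTransportDiagForcedOn T a κ u s' θ₀ θ where
  aestronglyMeasurable := h.aestronglyMeasurable
  aestronglyMeasurable_velocity := h.aestronglyMeasurable_velocity
  aestronglyMeasurable_source := by
    refine h.aestronglyMeasurable_source.congr ?_
    filter_upwards [ae_restrict_mem (measurableSet_Ioo.prod MeasurableSet.univ)] with p hp
    obtain ⟨t, y⟩ := p
    simp only [FunctionSpaces.Torus.stLift_apply, hss' t (mem_prod.1 hp).1]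
  ae_lintegral_sq_le := h.ae_lintegral_sq_le
  lintegral_velocity_lt_top := h.lintegral_velocity_lt_top
  lintegral_mul_lt_top := h.lintegral_mul_lt_top
  lintegral_source_lt_top := by
    rw [setLIntegral_congr_fun measurableSet_Ioo
      (fun t ht => show ∫⁻ x, ‖s' t x‖ₑ = ∫⁻ x, ‖s t x‖ₑ by rw [hss' t ht])]
    exact h.lintegral_source_lt_top
  ae_isWeaklyDivFree := h.ae_isWeaklyDivFree
  weak_eq ψ hψ := by
    rw [setIntegral_congr_fun measurableSet_Ioo
      (fun t ht => show (∫ x, s' t x * ψ t x) = ∫ x, s t x * ψ t x by rw [hss' t ht])]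
    exact h.weak_eq ψ hψ

/-- **Shrinking the horizon**: a weak solution on `[0,T)` is a weak solution on `[0,T')` for
every `T' ≤ T` (test functions on `[0,T')` are test functions on `[0,T)` and vanish on `[T',T)`).
[cite: DiPernaLions1989, §II.1 (12)–(14)] -/
theorem mono {T' : ℝ} (h : IsWeakScalarTransportDiagForcedOn T a κ u s θ₀ θ) (hT' : T' ≤ T) :
    IsWeakScalarTransportDiagForcedOn T' a κ u s θ₀ θ := by
  have hsub : Ioo 0 T' ⊆ Ioo 0 T := Ioo_subset_Ioo le_rfl hT'
  have hle : (volume : Measure ℝ).restrict (Ioo 0 T') ≤ volume.restrict (Ioo 0 T) :=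
    Measure.restrict_mono_set _ hsub
  have hleP : (volume : Measure (ℝ × EuclideanSpace ℝ d)).restrict (Ioo 0 T' ×ˢ univ) ≤
      volume.restrict (Ioo 0 T ×ˢ univ) :=
    Measure.restrict_mono_set _ (prod_mono hsub le_rfl)
  obtain ⟨C, hC⟩ := h.ae_lintegral_sq_le
  refine ⟨h.aestronglyMeasurable.mono_measure hleP, h.aestronglyMeasurable_velocity.mono_measure hleP,
    h.aestronglyMeasurable_source.mono_measure hleP, ⟨C, ae_mono hle hC⟩,
    (lintegral_mono_set hsub).trans_lt h.lintegral_velocity_lt_top,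
    (lintegral_mono_set hsub).trans_lt h.lintegral_mul_lt_top,
    (lintegral_mono_set hsub).trans_lt h.lintegral_source_lt_top, ae_mono hle h.ae_isWeaklyDivFree,
    fun ψ hψ => ?_⟩
  obtain ⟨hψs, T₁, hT₁, hψ0⟩ := hψ
  have hψT : FunctionSpaces.Torus.IsSpaceTimeTest T ψ := ⟨hψs, T₁, hT₁.trans_le hT', hψ0⟩
  have key := h.weak_eq ψ hψT
  -- the integrands vanish on `[T', T)`
  have hvan : ∀ t, T' ≤ t → ∀ x, ψ t x = 0 ∧ FunctionSpaces.Torus.timeDeriv ψ t x = 0 ∧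
      FunctionSpaces.Torus.gradient (ψ t) x = 0 ∧
      (∑ i, a i * FunctionSpaces.Torus.partialDeriv i (FunctionSpaces.Torus.partialDeriv i (ψ t)) x) = 0 := by
    intro t ht x
    have hz : ψ t = 0 := hψ0 t (hT₁.le.trans ht)
    have hzf : ψ t = fun _ => (0 : ℝ) := hz
    refine ⟨by rw [hz]; rfl, ?_, ?_, ?_⟩
    · have hev : (fun τ => ψ τ x) =ᶠ[nhds t] fun _ => (0 : ℝ) := by
        filter_upwards [Ioi_mem_nhds (hT₁.trans_le ht)] with τ hτ
        rw [hψ0 τ hτ.le]; rfl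
      change deriv (fun τ => ψ τ x) t = 0
      rw [hev.deriv_eq, deriv_const]
    · rw [hzf]
      have hl : FunctionSpaces.Torus.liftAt (fun _ : UnitAddTorus d => (0 : ℝ)) x = fun _ => 0 := by
        funext v; simp [FunctionSpaces.Torus.liftAt_apply]
      simp [FunctionSpaces.Torus.gradient, hl]
    · rw [hzf]
      simp [FunctionSpaces.Torus.partialDeriv, FunctionSpaces.Torus.lineDeriv]
  have e1 : ∫ t in Ioo 0 T, ∫ x, θ t x * (FunctionSpaces.Torus.timeDeriv ψ t x +
        ⟪u t x, FunctionSpaces.Torus.gradient (ψ t) x⟫_ℝ +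
        κ * ∑ i, a i * FunctionSpaces.Torus.partialDeriv i
          (FunctionSpaces.Torus.partialDeriv i (ψ t)) x) =
      ∫ t in Ioo 0 T', ∫ x, θ t x * (FunctionSpaces.Torus.timeDeriv ψ t x +
        ⟪u t x, FunctionSpaces.Torus.gradient (ψ t) x⟫_ℝ +
        κ * ∑ i, a i * FunctionSpaces.Torus.partialDeriv i
          (FunctionSpaces.Torus.partialDeriv i (ψ t)) x) := by
    refine setIntegral_eq_of_subset_of_forall_sdiff_eq_zero measurableSet_Ioo hsub fun t ht => ?_
    have htT' : T' ≤ t := by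
      by_contra hlt
      exact ht.2 ⟨ht.1.1, lt_of_not_ge hlt⟩
    refine integral_eq_zero_of_ae (Eventually.of_forall fun x => ?_)
    obtain ⟨-, h2, h3, h4⟩ := hvan t htT' x
    simp [h2, h3, h4]
  have e2 : ∫ t in Ioo 0 T, ∫ x, s t x * ψ t x = ∫ t in Ioo 0 T', ∫ x, s t x * ψ t x := by
    refine setIntegral_eq_of_subset_of_forall_sdiff_eq_zero measurableSet_Ioo hsub fun t ht => ?_
    have htT' : T' ≤ t := by
      by_contra hlt
      exact ht.2 ⟨ht.1.1, lt_of_not_ge hlt⟩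
    refine integral_eq_zero_of_ae (Eventually.of_forall fun x => ?_)
    simp [(hvan t htT' x).1]
  rw [e1, e2] at key
  exact key

/-! ## Integer periods of a time-periodic drift and source -/

omit [Fintype d] [DecidableEq d] in
/-- A field `L`-periodic on `t ≥ 0` is `nL`-periodic there for every `n : ℕ`. [folklore] -/
private theorem periodic_natMulPhase {X : Type*} {v : ℝ → X} {L : ℝ}
    (hL : 0 ≤ L) (hper : ∀ t : ℝ, 0 ≤ t → v (t + L) = v t) (n : ℕ) {t : ℝ} (ht : 0 ≤ t) :
    v (n * L + t) = v t := by
  induction n generalizing t with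
  | zero => simp
  | succ n ih =>
    have e : ((n + 1 : ℕ) : ℝ) * L + t = n * L + (t + L) := by push_cast; ring
    rw [e, ih (by positivity), hper t ht]

/-- **Integer periods see the same weak solutions**: for a drift and a source `L`-periodic on
`t ≥ 0` (`L ≥ 0`), the phase-`nL` problem (drift `t ↦ u (nL + t)`, source `t ↦ s (nL + t)`) and
the phase-`0` problem have the same weak solutions on `[0,T)` for every datum
(`congr_velocity`, `congr_source`, `periodic_natMulPhase`). Hence a phase-`0` statement quantified
over all weak solutions (e.g. the estimates of `HessChildsRowan2025a_cor13`) holds verbatim from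
every integer multiple of the period. [cite: DiPernaLions1989, §II.1 (12)–(14)] -/
theorem intPhase_iff {L : ℝ} (hL : 0 ≤ L) (hu : ∀ t : ℝ, 0 ≤ t → u (t + L) = u t)
    (hs : ∀ t : ℝ, 0 ≤ t → s (t + L) = s t) (n : ℕ) :
    IsWeakScalarTransportDiagForcedOn T a κ (fun t => u (n * L + t)) (fun t => s (n * L + t)) θ₀ θ ↔
      IsWeakScalarTransportDiagForcedOn T a κ u s θ₀ θ := by
  constructor
  · intro h
    exact (h.congr_velocity (u' := u) fun t ht => (periodic_natMulPhase hL hu n ht.1.le).symm).congr_source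
      fun t ht => (periodic_natMulPhase hL hs n ht.1.le).symm
  · intro h
    exact (h.congr_velocity (u' := fun t => u (n * L + t)) fun t ht =>
      periodic_natMulPhase hL hu n ht.1.le).congr_source fun t ht => periodic_natMulPhase hL hs n ht.1.le

/-- Steady-source form of `intPhase_iff`: for a drift `L`-periodic on `t ≥ 0` and a
time-independent source, the phase-`nL` drift has the same weak solutions as the phase-`0`
drift. [cite: DiPernaLions1989, §II.1 (12)–(14)] -/
theorem intPhase_iff_of_steady {L : ℝ} (hL : 0 ≤ L) (hu : ∀ t : ℝ, 0 ≤ t → u (t + L) = u t)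
    {S : UnitAddTorus d → ℝ} (n : ℕ) :
    IsWeakScalarTransportDiagForcedOn T a κ (fun t => u (n * L + t)) (fun _ => S) θ₀ θ ↔
      IsWeakScalarTransportDiagForcedOn T a κ u (fun _ => S) θ₀ θ :=
  intPhase_iff (s := fun _ => S) hL hu (fun _ _ => rfl) n

/-! ## Modification on null sets of times -/

/-- **Modification on null sets of times**: a space–time measurable field `θ'` whose slices agree
a.e. with those of a weak solution `θ` for a.e. `t ∈ (0,T)` is a weak solution with the same
drift, source and datum (every clause of the weak class is an iterated integral over `(0,T)` or
an a.e. statement in `t`); e.g. the weakly continuous representative of `θ`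
(`PassiveScalarDiagForcedTrace`) is itself a weak solution. Twin of
`IsWeakScalarTransportOn.congr_ae_slice`. [cite: DiPernaLions1989, §II.1 (12)–(14)] -/
theorem congr_ae_slice {θ' : ℝ → UnitAddTorus d → ℝ} (h : IsWeakScalarTransportDiagForcedOn T a κ u s θ₀ θ)
    (hm : AEStronglyMeasurable (FunctionSpaces.Torus.stLift θ') (volume.restrict (Ioo 0 T ×ˢ univ)))
    (hae : ∀ᵐ t ∂(volume.restrict (Ioo 0 T)), θ' t =ᵐ[volume] θ t) :
    IsWeakScalarTransportDiagForcedOn T a κ u s θ₀ θ' := by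
  obtain ⟨C, hC⟩ := h.ae_lintegral_sq_le
  refine ⟨hm, h.aestronglyMeasurable_velocity, h.aestronglyMeasurable_source, ⟨C, ?_⟩,
    h.lintegral_velocity_lt_top, ?_, h.lintegral_source_lt_top, h.ae_isWeaklyDivFree, fun ψ hψ => ?_⟩
  · filter_upwards [hC, hae] with t ht hte
    have e : ∫⁻ x, ‖θ' t x‖ₑ ^ 2 = ∫⁻ x, ‖θ t x‖ₑ ^ 2 :=
      lintegral_congr_ae (hte.mono fun x hx => by simp only [hx])
    rw [e]
    exact ht
  · have e : ∫⁻ t in Ioo 0 T, ∫⁻ x, ‖u t x‖ₑ * ‖θ' t x‖ₑ = ∫⁻ t in Ioo 0 T, ∫⁻ x, ‖u t x‖ₑ * ‖θ t x‖ₑ := by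
      refine lintegral_congr_ae ?_
      filter_upwards [hae] with t hte
      exact lintegral_congr_ae (hte.mono fun x hx => by simp only [hx])
    rw [e]
    exact h.lintegral_mul_lt_top
  · have e : (∫ t in Ioo 0 T, ∫ x, θ' t x *
        (FunctionSpaces.Torus.timeDeriv ψ t x + ⟪u t x, FunctionSpaces.Torus.gradient (ψ t) x⟫_ℝ +
          κ * ∑ i, a i * FunctionSpaces.Torus.partialDeriv i
            (FunctionSpaces.Torus.partialDeriv i (ψ t)) x)) =
        ∫ t in Ioo 0 T, ∫ x, θ t x *
          (FunctionSpaces.Torus.timeDeriv ψ t x + ⟪u t x, FunctionSpaces.Torus.gradient (ψ t) x⟫_ℝ +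
            κ * ∑ i, a i * FunctionSpaces.Torus.partialDeriv i
              (FunctionSpaces.Torus.partialDeriv i (ψ t)) x) := by
      refine integral_congr_ae ?_
      filter_upwards [hae] with t hte
      exact integral_congr_ae (hte.mono fun x hx => by simp only [hx])
    rw [e]
    exact h.weak_eq ψ hψ

/-- The datum may be replaced by any function with the same pairings against smooth fields (in
particular by an a.e.-equal one, both integrable): the weak formulation sees `θ₀` only through
`∫ θ₀ ψ(0)`. [cite: DiPernaLions1989, §II.1 (12)–(14)] -/
theorem congr_datum {θ₀' : UnitAddTorus d → ℝ} (h : IsWeakScalarTransportDiagForcedOn T a κ u s θ₀ θ)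
    (h₀ : ∀ g : UnitAddTorus d → ℝ, FunctionSpaces.Torus.IsSmooth g → ∫ x, θ₀' x * g x = ∫ x, θ₀ x * g x) :
    IsWeakScalarTransportDiagForcedOn T a κ u s θ₀' θ := by
  refine ⟨h.aestronglyMeasurable, h.aestronglyMeasurable_velocity, h.aestronglyMeasurable_source,
    h.ae_lintegral_sq_le, h.lintegral_velocity_lt_top, h.lintegral_mul_lt_top, h.lintegral_source_lt_top,
    h.ae_isWeaklyDivFree, fun ψ hψ => ?_⟩
  rw [h₀ (ψ 0) (hψ.isSmooth_slice 0)]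
  exact h.weak_eq ψ hψ

/-- A.e.-equal integrable data give the same weak solutions. [cite: DiPernaLions1989, §II.1 (12)–(14)] -/
theorem congr_datum_ae {θ₀' : UnitAddTorus d → ℝ} (h : IsWeakScalarTransportDiagForcedOn T a κ u s θ₀ θ)
    (h₀ : θ₀' =ᵐ[volume] θ₀) :
    IsWeakScalarTransportDiagForcedOn T a κ u s θ₀' θ :=
  h.congr_datum fun g _ => integral_congr_ae (h₀.mono fun x hx => by simp only [hx])

end IsWeakScalarTransportDiagForcedOn

end Torus

end Literature.Analysis.FluidPDE

end
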